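import Summits.ValiantsHypothesis.ValiantsHypothesis.Theorems.LacunarySymmetroidMatrixDescartesPivotTwoDirectionsAnySizeBlock
import Summits.ValiantsHypothesis.ValiantsHypothesis.Theorems.LacunarySymmetroidMatrixDescartesWLawTwoSignBudgets

/-!
# `MatrixDescartes` census — the `(2,2)` block with ONE DIRECTION STRADDLING THE PIVOT: `Z₊ ≤ 7` everywhere,
# `Z₊ ≤ 5` outside three explicit «stuck» exponent chambers (every size `m + 2`)

HONEST FRAMING.  Object-search cell `pub-symmetroid`, seat `val-sym-mdr-p2` (generation 25); helper file `--supports` the crux item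
stmt-ValiantsHypothesis-18050 (`Theses.LacunarySymmetroid.MatrixDescartes`, OPEN, on HOLD) with NO closure claim.  The BLOCK `(2,2)` QUESTION
of `…PivotTwoDirections` («rank-one letters in two directions ⇒ `Z₊ ≤ 2K − 2 = 6`?») is closed in the sign-separated configuration
(`…BlockLawAll`) and in the doubly-straddling one (`…PosEnds.posRoots_add_two_le_of_both_straddle`); `…BlockLawAll` records «letters of
one direction on both sides of the pivot» as open.  THIS FILE treats that configuration — `f = c₁X^{p₁} + c₂X^{p₂}` with
`p₂ < e < p₁` (the `u`-letters STRADDLE the pivot), `g = c₃X^{q₁} + c₄X^{q₂}` with `e < q₁ < q₂` (the `v`-letters above it), weak hard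
cell `dJ ≤ 0`, `mu < 0`, `mv ≤ 0`, `D2 > 0` — by Descartes bookkeeping on `−Φ` (positive coefficients of `Φ` live on the four PAIR degrees
`pᵢ + qⱼ`; the top degree `p₁ + q₂` is a pair degree):
* `straddle_nineNomial_le_seven`: **`Z₊ ≤ 7`** for every exponent configuration (two-ended budget);
* `straddle_nineNomial_le_five_of_adjacent`: two pair degrees ADJACENT in the degree order (no nine-nomial degree strictly between
  them) ⇒ **`Z₊ ≤ 5`** (`WLawTwoChambers.signVariations_pair_budget`);
* `adjacent_of_not_stuck` (linear arithmetic) / **`straddle_nineNomial_le_five_of_not_stuck`**: adjacency fails exactly in the STUCK SET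
  `p₁ + q₁ < e + q₂ ∧ (p₂ + q₂ < e + p₁ ∨ p₂ + q₂ < e + q₁) ∧ (p₂ + q₁ < 2e < p₂ + q₂ ∨ p₂ + q₁ < e + p₁ < p₂ + q₂ ∨ e + q₁ < p₂ + q₂)`
  (five open chambers of perfect interleaving `N P N N P N P N P`, …, plus their pair/pivot-degree collisions; Descartes count `7` there),
  so **`Z₊ ≤ 5` OUTSIDE it**; with `α = p₁ − e`, `β = e − p₂`, `γ = q₁ − e`, `δ = q₂ − e` the stuck set reads
  `α + γ < δ ∧ δ − β < max(α, γ) ∧ (γ < β < δ ∨ γ − β < α < δ − β ∨ β + γ < δ)` — the far `v`-letter beats the two near scales together;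
* matrix forms at EVERY size `m + 2` (`straddleBlock_anySize_posRoots_le_seven`, `straddleBlock_anySize_posRoots_le_five_of_not_stuck`) through
  `AnySize.posRoots_twoDir_anySize_eq` + `AnySize.Φ_block22_eq_nineNomial`.
What remains of the block `(2,2)` question is therefore: `Z₊ ≤ 6` (numerically `≤ 5`: at most four critical points of
`G = a/P̃ + b/R̃ + κ/(P̃R̃)` located) INSIDE the stuck set — a kill-seven problem in five chambers, recorded for a successor.
Nothing here bears on `Theses.LacunarySymmetroid.MatrixDescartes` in its window, on `KPlusLogSqLaw`, on `DoorA26` / `DoorA34`, on the cell's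
registers or credences, or on `VP ≠ VNP`.

[folklore] Descartes' rule with the two-ended and pair budgets of the census library; tree lemmas named above.  No definitions, no named facts.
-/

-- `Summit.ValiantsHypothesis.ValiantsHypothesis.…` repeats a component by the D-0017 layout
-- (single-conjunct summit), which the `dupNamespace` linter flags; the name is mandated.
set_option linter.dupNamespace false

namespace Summit.ValiantsHypothesis.ValiantsHypothesis.Theorems.LacunarySymmetroidMatrixDescartes.Pivot.TwoDirections.BlockStraddle

open Polynomial Matrix Finset
open scoped BigOperators

/-! ## 1. The straddling nine-nomial: ends, and positive coefficients only at the four pair degrees -/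

/-- In the straddling order `p₂ < e < p₁`, `e < q₁ < q₂` the nine-nomial has degree `p₁ + q₂` and leading coefficient `c₇` (position `7`)
when that coefficient is non-zero. -/
theorem leadingCoeff_nineNomial_straddle (e p₁ p₂ q₁ q₂ : ℕ) (h2e : p₂ < e) (he1 : e < p₁) (heq : e < q₁) (h12 : q₁ < q₂)
    (cv : Fin 9 → ℝ) (h7 : cv 7 ≠ 0) : (∑ i : Fin 9, Polynomial.C (cv i) * X ^ ((![2 * e, e + p₁, e + p₂, e + q₁, e + q₂, p₁ + q₁, p₂ + q₁, p₁ + q₂, p₂ + q₂] : Fin 9 → ℕ) i)).leadingCoeff = cv 7 := by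
  have hcoef : (∑ i : Fin 9, Polynomial.C (cv i) * X ^ ((![2 * e, e + p₁, e + p₂, e + q₁, e + q₂, p₁ + q₁, p₂ + q₁, p₁ + q₂, p₂ + q₂] : Fin 9 → ℕ) i)).coeff (p₁ + q₂) = cv 7 := by
    rw [BlockLawAll.coeff_nineNomial, Finset.sum_eq_single (7 : Fin 9)]
    · simp
    · intro i _ hi
      fin_cases i <;> simp at hi ⊢ <;> omega
    · simp
  have hle : (∑ i : Fin 9, Polynomial.C (cv i) * X ^ ((![2 * e, e + p₁, e + p₂, e + q₁, e + q₂, p₁ + q₁, p₂ + q₁, p₁ + q₂, p₂ + q₂] : Fin 9 → ℕ) i)).natDegree ≤ p₁ + q₂ := by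
    refine natDegree_sum_le_of_forall_le _ _ fun i _ => (natDegree_C_mul_X_pow_le _ _).trans ?_
    fin_cases i <;> simp <;> omega
  have hdeg : (∑ i : Fin 9, Polynomial.C (cv i) * X ^ ((![2 * e, e + p₁, e + p₂, e + q₁, e + q₂, p₁ + q₁, p₂ + q₁, p₁ + q₂, p₂ + q₂] : Fin 9 → ℕ) i)).natDegree = p₁ + q₂ := natDegree_eq_of_le_of_coeff_ne_zero hle (by rw [hcoef]; exact h7)
  change (∑ i : Fin 9, Polynomial.C (cv i) * X ^ ((![2 * e, e + p₁, e + p₂, e + q₁, e + q₂, p₁ + q₁, p₂ + q₁, p₁ + q₂, p₂ + q₂] : Fin 9 → ℕ) i)).coeff (∑ i : Fin 9, Polynomial.C (cv i) * X ^ ((![2 * e, e + p₁, e + p₂, e + q₁, e + q₂, p₁ + q₁, p₂ + q₁, p₁ + q₂, p₂ + q₂] : Fin 9 → ℕ) i)).natDegree = cv 7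
  rw [hdeg, hcoef]

/-- In the straddling order the nine-nomial has trailing degree `e + p₂` and trailing coefficient `c₂` (position `2`) when that coefficient
is non-zero. -/
theorem trailingCoeff_nineNomial_straddle (e p₁ p₂ q₁ q₂ : ℕ) (h2e : p₂ < e) (he1 : e < p₁) (heq : e < q₁) (h12 : q₁ < q₂)
    (cv : Fin 9 → ℝ) (h2 : cv 2 ≠ 0) : (∑ i : Fin 9, Polynomial.C (cv i) * X ^ ((![2 * e, e + p₁, e + p₂, e + q₁, e + q₂, p₁ + q₁, p₂ + q₁, p₁ + q₂, p₂ + q₂] : Fin 9 → ℕ) i)).trailingCoeff = cv 2 := by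
  have hcoef : (∑ i : Fin 9, Polynomial.C (cv i) * X ^ ((![2 * e, e + p₁, e + p₂, e + q₁, e + q₂, p₁ + q₁, p₂ + q₁, p₁ + q₂, p₂ + q₂] : Fin 9 → ℕ) i)).coeff (e + p₂) = cv 2 := by
    rw [BlockLawAll.coeff_nineNomial, Finset.sum_eq_single (2 : Fin 9)]
    · simp
    · intro i _ hi
      fin_cases i <;> simp at hi ⊢ <;> omega
    · simp
  have hne : (∑ i : Fin 9, Polynomial.C (cv i) * X ^ ((![2 * e, e + p₁, e + p₂, e + q₁, e + q₂, p₁ + q₁, p₂ + q₁, p₁ + q₂, p₂ + q₂] : Fin 9 → ℕ) i)) ≠ 0 := fun h0 => by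
    have := hcoef; rw [h0, coeff_zero] at this; exact h2 this.symm
  have hge : e + p₂ ≤ (∑ i : Fin 9, Polynomial.C (cv i) * X ^ ((![2 * e, e + p₁, e + p₂, e + q₁, e + q₂, p₁ + q₁, p₂ + q₁, p₁ + q₂, p₂ + q₂] : Fin 9 → ℕ) i)).natTrailingDegree := by
    refine le_natTrailingDegree hne fun m hm => ?_
    rw [BlockLawAll.coeff_nineNomial]
    refine Finset.sum_eq_zero fun i _ => ?_
    rw [if_neg]
    fin_cases i <;> simp <;> omega
  have hle : (∑ i : Fin 9, Polynomial.C (cv i) * X ^ ((![2 * e, e + p₁, e + p₂, e + q₁, e + q₂, p₁ + q₁, p₂ + q₁, p₁ + q₂, p₂ + q₂] : Fin 9 → ℕ) i)).natTrailingDegree ≤ e + p₂ := natTrailingDegree_le_of_ne_zero (by rw [hcoef]; exact h2)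
  change (∑ i : Fin 9, Polynomial.C (cv i) * X ^ ((![2 * e, e + p₁, e + p₂, e + q₁, e + q₂, p₁ + q₁, p₂ + q₁, p₁ + q₂, p₂ + q₂] : Fin 9 → ℕ) i)).coeff (∑ i : Fin 9, Polynomial.C (cv i) * X ^ ((![2 * e, e + p₁, e + p₂, e + q₁, e + q₂, p₁ + q₁, p₂ + q₁, p₁ + q₂, p₂ + q₂] : Fin 9 → ℕ) i)).natTrailingDegree = cv 2
  rw [le_antisymm hle hge, hcoef]

/-- With non-positive PIVOT-TYPE coefficients (positions `0, …, 4`), a negative coefficient of `−Φ` (a positive one of `Φ`) sits at one of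
the four pair degrees. -/
theorem mem_pairDegrees_of_coeff_neg_neg (e p₁ p₂ q₁ q₂ : ℕ) (cv : Fin 9 → ℝ) (hnp : ∀ i : Fin 9, (i : ℕ) < 5 → cv i ≤ 0) (m : ℕ)
    (hm : (-(∑ i : Fin 9, Polynomial.C (cv i) * X ^ ((![2 * e, e + p₁, e + p₂, e + q₁, e + q₂, p₁ + q₁, p₂ + q₁, p₁ + q₂, p₂ + q₂] : Fin 9 → ℕ) i))).coeff m < 0) :
    m ∈ ({p₁ + q₁, p₂ + q₁, p₁ + q₂, p₂ + q₂} : Finset ℕ) := by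
  rw [coeff_neg, neg_lt_zero, BlockLawAll.coeff_nineNomial] at hm
  simp only [Finset.mem_insert, Finset.mem_singleton]
  by_contra hcon
  push Not at hcon
  obtain ⟨h1, h2, h3, h4⟩ := hcon
  refine absurd hm (not_lt.mpr (Finset.sum_nonpos fun i _ => ?_))
  fin_cases i <;> (split_ifs with h) <;> first
      | exact le_rfl
      | exact absurd h h1 | exact absurd h h2 | exact absurd h h3 | exact absurd h h4
      | exact hnp _ (by simp)

/-! ## 2. `Z₊ ≤ 7` everywhere; `Z₊ ≤ 5` when two pair degrees are adjacent -/

/-- **`Z₊ ≤ 7` FOR THE STRADDLING `(2,2)` NINE-NOMIAL** (real-parameter form): pivot-type coefficients `≤ 0`, the trailing one (`c₂`, degree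
`e + p₂`) `< 0`, the top pair coefficient (`c₇`, degree `p₁ + q₂`) `> 0`: the positive coefficients occupy at most the four pair degrees and
the top one is positive, so `Var(−Φ) + 1 ≤ 8`. [this file] -/
theorem straddle_nineNomial_le_seven (e p₁ p₂ q₁ q₂ : ℕ) (h2e : p₂ < e) (he1 : e < p₁) (heq : e < q₁) (h12 : q₁ < q₂)
    (cv : Fin 9 → ℝ) (hnp : ∀ i : Fin 9, (i : ℕ) < 5 → cv i ≤ 0) (h2 : cv 2 < 0) (h7 : 0 < cv 7) :
    ((∑ i : Fin 9, Polynomial.C (cv i) * X ^ ((![2 * e, e + p₁, e + p₂, e + q₁, e + q₂, p₁ + q₁, p₂ + q₁, p₁ + q₂, p₂ + q₂] : Fin 9 → ℕ) i)).roots.toFinset.filter (fun t => 0 < t)).card ≤ 7 := by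
  classical
  set f := (∑ i : Fin 9, Polynomial.C (cv i) * X ^ ((![2 * e, e + p₁, e + p₂, e + q₁, e + q₂, p₁ + q₁, p₂ + q₁, p₁ + q₂, p₂ + q₂] : Fin 9 → ℕ) i)) with hf
  have hlead : (-f).leadingCoeff < 0 := by
    rw [leadingCoeff_neg, hf, leadingCoeff_nineNomial_straddle e p₁ p₂ q₁ q₂ h2e he1 heq h12 cv h7.ne']; linarith
  have htrail : ¬ (-f).trailingCoeff < 0 := by
    rw [PosEnds.trailingCoeff_neg', hf, trailingCoeff_nineNomial_straddle e p₁ p₂ q₁ q₂ h2e he1 heq h12 cv h2.ne]; linarith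
  have hsub : TwoDescartes.negSupp (-f) ⊆ ({p₁ + q₁, p₂ + q₁, p₁ + q₂, p₂ + q₂} : Finset ℕ) := by
    intro n hn
    simp only [TwoDescartes.negSupp, Finset.mem_filter] at hn
    exact mem_pairDegrees_of_coeff_neg_neg e p₁ p₂ q₁ q₂ cv hnp n hn.2
  have hbudget := Census.signVariations_two_ended_le (-f)
  rw [if_pos hlead, if_neg htrail, signVariations_neg] at hbudget
  have hc := (Finset.card_le_card hsub).trans (Finset.card_le_four : ({p₁ + q₁, p₂ + q₁, p₁ + q₂, p₂ + q₂} : Finset ℕ).card ≤ 4)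
  refine (WLawTwoChambers.card_posRoots_le_signVariations f).trans ?_
  omega

/-- **TWO ADJACENT PAIR DEGREES ⇒ `Z₊ ≤ 5`.**  Pivot-type coefficients `≤ 0`, top pair coefficient `> 0`, and two pair degrees `u < v` with no nine-nomial degree
strictly between them: the pair budget on `−Φ` gives `Var + 1 + 2 ≤ 8`. [this file] -/
theorem straddle_nineNomial_le_five_of_adjacent (e p₁ p₂ q₁ q₂ : ℕ) (h2e : p₂ < e) (he1 : e < p₁) (heq : e < q₁) (h12 : q₁ < q₂)
    (cv : Fin 9 → ℝ) (hnp : ∀ i : Fin 9, (i : ℕ) < 5 → cv i ≤ 0) (h7 : 0 < cv 7)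
    (u v : ℕ) (huv : u < v) (hu : u ∈ ({p₁ + q₁, p₂ + q₁, p₁ + q₂, p₂ + q₂} : Finset ℕ))
    (hv : v ∈ ({p₁ + q₁, p₂ + q₁, p₁ + q₂, p₂ + q₂} : Finset ℕ))
    (hgap : ∀ i : Fin 9, (![2 * e, e + p₁, e + p₂, e + q₁, e + q₂, p₁ + q₁, p₂ + q₁, p₁ + q₂, p₂ + q₂] : Fin 9 → ℕ) i ≤ u
      ∨ v ≤ (![2 * e, e + p₁, e + p₂, e + q₁, e + q₂, p₁ + q₁, p₂ + q₁, p₁ + q₂, p₂ + q₂] : Fin 9 → ℕ) i) :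
    ((∑ i : Fin 9, Polynomial.C (cv i) * X ^ ((![2 * e, e + p₁, e + p₂, e + q₁, e + q₂, p₁ + q₁, p₂ + q₁, p₁ + q₂, p₂ + q₂] : Fin 9 → ℕ) i)).roots.toFinset.filter (fun t => 0 < t)).card ≤ 5 := by
  classical
  set f := (∑ i : Fin 9, Polynomial.C (cv i) * X ^ ((![2 * e, e + p₁, e + p₂, e + q₁, e + q₂, p₁ + q₁, p₂ + q₁, p₁ + q₂, p₂ + q₂] : Fin 9 → ℕ) i)) with hf
  have hlead : (-f).leadingCoeff < 0 := by
    rw [leadingCoeff_neg, hf, leadingCoeff_nineNomial_straddle e p₁ p₂ q₁ q₂ h2e he1 heq h12 cv h7.ne']; linarith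
  have hT : ∀ n, (-f).coeff n < 0 → n ∈ ({p₁ + q₁, p₂ + q₁, p₁ + q₂, p₂ + q₂} : Finset ℕ) :=
    fun n hn => mem_pairDegrees_of_coeff_neg_neg e p₁ p₂ q₁ q₂ cv hnp n hn
  have hzero : ∀ m, u < m → m < v → (-f).coeff m = 0 := by
    intro m hum hmv
    rw [coeff_neg, neg_eq_zero, hf, BlockLawAll.coeff_nineNomial]
    refine Finset.sum_eq_zero fun i _ => ?_
    rw [if_neg]
    intro hmi
    rcases hgap i with h | h
    · rw [← hmi] at h; omega
    · rw [← hmi] at h; omega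
  have hbudget := WLawTwoChambers.signVariations_pair_budget (-f) _ hT u v huv hu hv hzero
  rw [if_pos hlead, signVariations_neg] at hbudget
  have hc : ({p₁ + q₁, p₂ + q₁, p₁ + q₂, p₂ + q₂} : Finset ℕ).card ≤ 4 := Finset.card_le_four
  refine (WLawTwoChambers.card_posRoots_le_signVariations f).trans ?_
  omega

/-! ## 3. The stuck set: where no two pair degrees are adjacent (linear arithmetic) -/

/-- **Outside the stuck set two pair degrees are adjacent (or two of them coincide).**  For `p₂ < e < p₁`, `e < q₁ < q₂`: unless
`p₁ + q₁ < e + q₂ ∧ (p₂ + q₂ < e + p₁ ∨ p₂ + q₂ < e + q₁) ∧ (p₂ + q₁ < 2e < p₂ + q₂ ∨ p₂ + q₁ < e + p₁ < p₂ + q₂ ∨ e + q₁ < p₂ + q₂)`,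
either `p₁ + q₁ = p₂ + q₂` or some two pair degrees `u < v` have no nine-nomial degree strictly between them. [linear arithmetic] -/
theorem adjacent_of_not_stuck (e p₁ p₂ q₁ q₂ : ℕ) (h2e : p₂ < e) (he1 : e < p₁) (heq : e < q₁) (h12 : q₁ < q₂)
    (hS : ¬ (p₁ + q₁ < e + q₂ ∧ (p₂ + q₂ < e + p₁ ∨ p₂ + q₂ < e + q₁)
      ∧ ((p₂ + q₁ < 2 * e ∧ 2 * e < p₂ + q₂) ∨ (p₂ + q₁ < e + p₁ ∧ e + p₁ < p₂ + q₂) ∨ e + q₁ < p₂ + q₂))) :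
    p₁ + q₁ = p₂ + q₂ ∨ ∃ u v : ℕ, u < v ∧ u ∈ ({p₁ + q₁, p₂ + q₁, p₁ + q₂, p₂ + q₂} : Finset ℕ)
      ∧ v ∈ ({p₁ + q₁, p₂ + q₁, p₁ + q₂, p₂ + q₂} : Finset ℕ)
      ∧ ∀ i : Fin 9, (![2 * e, e + p₁, e + p₂, e + q₁, e + q₂, p₁ + q₁, p₂ + q₁, p₁ + q₂, p₂ + q₂] : Fin 9 → ℕ) i ≤ u
        ∨ v ≤ (![2 * e, e + p₁, e + p₂, e + q₁, e + q₂, p₁ + q₁, p₂ + q₁, p₁ + q₂, p₂ + q₂] : Fin 9 → ℕ) i := by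
  rcases Nat.lt_trichotomy (p₁ + q₁) (p₂ + q₂) with hlt | hEq | hgt
  · -- `p₁ + q₁ < p₂ + q₂`: nothing lies strictly between them
    refine Or.inr ⟨p₁ + q₁, p₂ + q₂, hlt, by simp, by simp, fun i => ?_⟩
    fin_cases i <;> simp <;> omega
  · exact Or.inl hEq
  · right
    by_cases htop : e + q₂ ≤ p₁ + q₁
    · -- the top gap `(p₁ + q₁, p₁ + q₂)` carries no degree
      refine ⟨p₁ + q₁, p₁ + q₂, by omega, by simp, by simp, fun i => ?_⟩
      fin_cases i <;> simp <;> omega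
    simp only [not_and_or, not_or, not_lt] at hS
    rcases hS with h3 | h2' | h1'
    · exact absurd h3 htop
    · -- the middle gap `(p₂ + q₂, p₁ + q₁)` carries no degree
      refine ⟨p₂ + q₂, p₁ + q₁, hgt, by simp, by simp, fun i => ?_⟩
      fin_cases i <;> simp <;> omega
    · -- the bottom gap `(p₂ + q₁, p₂ + q₂)` carries no degree
      refine ⟨p₂ + q₁, p₂ + q₂, by omega, by simp, by simp, fun i => ?_⟩
      fin_cases i <;> simp <;> omega

/-- **`Z₊ ≤ 5` OUTSIDE THE STUCK SET** (real-parameter form). [this file] -/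
theorem straddle_nineNomial_le_five_of_not_stuck (e p₁ p₂ q₁ q₂ : ℕ) (h2e : p₂ < e) (he1 : e < p₁) (heq : e < q₁) (h12 : q₁ < q₂)
    (hS : ¬ (p₁ + q₁ < e + q₂ ∧ (p₂ + q₂ < e + p₁ ∨ p₂ + q₂ < e + q₁)
      ∧ ((p₂ + q₁ < 2 * e ∧ 2 * e < p₂ + q₂) ∨ (p₂ + q₁ < e + p₁ ∧ e + p₁ < p₂ + q₂) ∨ e + q₁ < p₂ + q₂)))
    (cv : Fin 9 → ℝ) (hnp : ∀ i : Fin 9, (i : ℕ) < 5 → cv i ≤ 0) (h2 : cv 2 < 0) (h7 : 0 < cv 7) :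
    ((∑ i : Fin 9, Polynomial.C (cv i) * X ^ ((![2 * e, e + p₁, e + p₂, e + q₁, e + q₂, p₁ + q₁, p₂ + q₁, p₁ + q₂, p₂ + q₂] : Fin 9 → ℕ) i)).roots.toFinset.filter (fun t => 0 < t)).card ≤ 5 := by
  classical
  rcases adjacent_of_not_stuck e p₁ p₂ q₁ q₂ h2e he1 heq h12 hS with hEq | ⟨u, v, huv, hu, hv, hgap⟩
  · -- two pair degrees coincide: at most three positive coefficients, the top one positive
    set f := (∑ i : Fin 9, Polynomial.C (cv i) * X ^ ((![2 * e, e + p₁, e + p₂, e + q₁, e + q₂, p₁ + q₁, p₂ + q₁, p₁ + q₂, p₂ + q₂] : Fin 9 → ℕ) i)) with hf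
    have hlead : (-f).leadingCoeff < 0 := by
      rw [leadingCoeff_neg, hf, leadingCoeff_nineNomial_straddle e p₁ p₂ q₁ q₂ h2e he1 heq h12 cv h7.ne']; linarith
    have htrail : ¬ (-f).trailingCoeff < 0 := by
      rw [PosEnds.trailingCoeff_neg', hf, trailingCoeff_nineNomial_straddle e p₁ p₂ q₁ q₂ h2e he1 heq h12 cv h2.ne]; linarith
    have hsub : TwoDescartes.negSupp (-f) ⊆ ({p₂ + q₁, p₁ + q₂, p₂ + q₂} : Finset ℕ) := by
      intro n hn
      simp only [TwoDescartes.negSupp, Finset.mem_filter] at hn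
      have h := mem_pairDegrees_of_coeff_neg_neg e p₁ p₂ q₁ q₂ cv hnp n hn.2
      simp only [Finset.mem_insert, Finset.mem_singleton] at h ⊢
      omega
    have hbudget := Census.signVariations_two_ended_le (-f)
    rw [if_pos hlead, if_neg htrail, signVariations_neg] at hbudget
    have hc := (Finset.card_le_card hsub).trans (Finset.card_le_three : ({p₂ + q₁, p₁ + q₂, p₂ + q₂} : Finset ℕ).card ≤ 3)
    refine (WLawTwoChambers.card_posRoots_le_signVariations f).trans ?_
    omega
  · exact straddle_nineNomial_le_five_of_adjacent e p₁ p₂ q₁ q₂ h2e he1 heq h12 cv hnp h7 u v huv hu hv hgap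

/-! ## 4. Block coefficients and the matrix forms at every size -/

/-- **THE STRADDLING `(2,2)` BLOCK: `Z₊ ≤ 7`** (hard-cell nine-nomial `Φ` of `u`-weights `c₁, c₂ > 0` at exponents `p₂ < e < p₁`, `v`-weights
`c₃, c₄ > 0` at `e < q₁ < q₂`, `dJ ≤ 0`, `mu < 0`, `mv ≤ 0`, `D2 > 0`). [this file] -/
theorem straddleBlock_nineNomial_le_seven (e p₁ p₂ q₁ q₂ : ℕ) (h2e : p₂ < e) (he1 : e < p₁) (heq : e < q₁) (h12 : q₁ < q₂)
    (dJ mu mv Δ2 c₁ c₂ c₃ c₄ : ℝ) (hc₁ : 0 < c₁) (hc₂ : 0 < c₂) (hc₃ : 0 < c₃) (hc₄ : 0 < c₄) (hdJ : dJ ≤ 0) (hmu : mu < 0) (hmv : mv ≤ 0)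
    (hΔ2p : 0 < Δ2) :
    ((∑ i : Fin 9, Polynomial.C ((![dJ, c₁ * mu, c₂ * mu, c₃ * mv, c₄ * mv, c₁ * c₃ * Δ2, c₂ * c₃ * Δ2, c₁ * c₄ * Δ2, c₂ * c₄ * Δ2] : Fin 9 → ℝ) i) * X ^ ((![2 * e, e + p₁, e + p₂, e + q₁, e + q₂, p₁ + q₁, p₂ + q₁, p₁ + q₂, p₂ + q₂] : Fin 9 → ℕ) i)).roots.toFinset.filter (fun t => 0 < t)).card ≤ 7 := by
  have hm₁ : c₁ * mu ≤ 0 := mul_nonpos_of_nonneg_of_nonpos hc₁.le hmu.le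
  have hm₂ : c₂ * mu ≤ 0 := mul_nonpos_of_nonneg_of_nonpos hc₂.le hmu.le
  have hm₃ : c₃ * mv ≤ 0 := mul_nonpos_of_nonneg_of_nonpos hc₃.le hmv
  have hm₄ : c₄ * mv ≤ 0 := mul_nonpos_of_nonneg_of_nonpos hc₄.le hmv
  refine straddle_nineNomial_le_seven e p₁ p₂ q₁ q₂ h2e he1 heq h12 _ (fun i hi => ?_) ?_ ?_
  · fin_cases i <;> simp at hi ⊢ <;> assumption
  · simp only [Fin.isValue, Matrix.cons_val]; exact mul_neg_of_pos_of_neg hc₂ hmu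
  · simp only [Fin.isValue, Matrix.cons_val]; positivity

/-- **THE STRADDLING `(2,2)` BLOCK OUTSIDE THE STUCK SET: `Z₊ ≤ 5`.** [this file] -/
theorem straddleBlock_nineNomial_le_five_of_not_stuck (e p₁ p₂ q₁ q₂ : ℕ) (h2e : p₂ < e) (he1 : e < p₁) (heq : e < q₁) (h12 : q₁ < q₂)
    (hS : ¬ (p₁ + q₁ < e + q₂ ∧ (p₂ + q₂ < e + p₁ ∨ p₂ + q₂ < e + q₁)
      ∧ ((p₂ + q₁ < 2 * e ∧ 2 * e < p₂ + q₂) ∨ (p₂ + q₁ < e + p₁ ∧ e + p₁ < p₂ + q₂) ∨ e + q₁ < p₂ + q₂)))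
    (dJ mu mv Δ2 c₁ c₂ c₃ c₄ : ℝ) (hc₁ : 0 < c₁) (hc₂ : 0 < c₂) (hc₃ : 0 < c₃) (hc₄ : 0 < c₄) (hdJ : dJ ≤ 0) (hmu : mu < 0) (hmv : mv ≤ 0)
    (hΔ2p : 0 < Δ2) :
    ((∑ i : Fin 9, Polynomial.C ((![dJ, c₁ * mu, c₂ * mu, c₃ * mv, c₄ * mv, c₁ * c₃ * Δ2, c₂ * c₃ * Δ2, c₁ * c₄ * Δ2, c₂ * c₄ * Δ2] : Fin 9 → ℝ) i) * X ^ ((![2 * e, e + p₁, e + p₂, e + q₁, e + q₂, p₁ + q₁, p₂ + q₁, p₁ + q₂, p₂ + q₂] : Fin 9 → ℕ) i)).roots.toFinset.filter (fun t => 0 < t)).card ≤ 5 := by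
  have hm₁ : c₁ * mu ≤ 0 := mul_nonpos_of_nonneg_of_nonpos hc₁.le hmu.le
  have hm₂ : c₂ * mu ≤ 0 := mul_nonpos_of_nonneg_of_nonpos hc₂.le hmu.le
  have hm₃ : c₃ * mv ≤ 0 := mul_nonpos_of_nonneg_of_nonpos hc₃.le hmv
  have hm₄ : c₄ * mv ≤ 0 := mul_nonpos_of_nonneg_of_nonpos hc₄.le hmv
  refine straddle_nineNomial_le_five_of_not_stuck e p₁ p₂ q₁ q₂ h2e he1 heq h12 hS _ (fun i hi => ?_) ?_ ?_
  · fin_cases i <;> simp at hi ⊢ <;> assumption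
  · simp only [Fin.isValue, Matrix.cons_val]; exact mul_neg_of_pos_of_neg hc₂ hmu
  · simp only [Fin.isValue, Matrix.cons_val]; positivity

variable {m : ℕ}

/-- **MATRIX FORM AT EVERY SIZE `m + 2`: `Z₊ ≤ 7`.**  `F = X^e J + (c₁X^{p₁} + c₂X^{p₂}) uuᵀ + (c₃X^{q₁} + c₄X^{q₂}) vvᵀ`, `p₂ < e < p₁`
(the `u`-letters straddle the pivot), `e < q₁ < q₂`, `cᵢ > 0`, size-`m + 2` weak hard cell `det J < 0`, `det J·(uᵀJ⁻¹u) < 0`,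
`det J·(vᵀJ⁻¹v) ≤ 0`, `det J·det(WᵀJ⁻¹W) > 0`. [this file + `…AnySize`] -/
theorem straddleBlock_anySize_posRoots_le_seven (e p₁ p₂ q₁ q₂ : ℕ) (h2e : p₂ < e) (he1 : e < p₁) (heq : e < q₁) (h12 : q₁ < q₂)
    (J : Matrix (Fin (m + 2)) (Fin (m + 2)) ℝ) (hJ : J.det < 0) (u v : Fin (m + 2) → ℝ) (c₁ c₂ c₃ c₄ : ℝ)
    (hc₁ : 0 < c₁) (hc₂ : 0 < c₂) (hc₃ : 0 < c₃) (hc₄ : 0 < c₄)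
    (hmu : J.det * (u ⬝ᵥ J⁻¹ *ᵥ u) < 0) (hmv : J.det * (v ⬝ᵥ J⁻¹ *ᵥ v) ≤ 0)
    (hD2 : 0 < J.det * ((u ⬝ᵥ J⁻¹ *ᵥ u) * (v ⬝ᵥ J⁻¹ *ᵥ v) - (u ⬝ᵥ J⁻¹ *ᵥ v) * (v ⬝ᵥ J⁻¹ *ᵥ u))) :
    ((Matrix.det (((X : ℝ[X]) ^ e) • J.map Polynomial.C
        + (Polynomial.C c₁ * X ^ p₁ + Polynomial.C c₂ * X ^ p₂) • (vecMulVec u u).map Polynomial.C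
        + (Polynomial.C c₃ * X ^ q₁ + Polynomial.C c₄ * X ^ q₂) • (vecMulVec v v).map Polynomial.C)).roots.toFinset.filter
        (fun t => 0 < t)).card ≤ 7 := by
  rw [AnySize.posRoots_twoDir_anySize_eq e J hJ.ne u v _ _, AnySize.Φ_block22_eq_nineNomial]
  exact straddleBlock_nineNomial_le_seven e p₁ p₂ q₁ q₂ h2e he1 heq h12 _ _ _ _ c₁ c₂ c₃ c₄ hc₁ hc₂ hc₃ hc₄ hJ.le hmu hmv hD2

/-- **MATRIX FORM AT EVERY SIZE `m + 2`: `Z₊ ≤ 5` OUTSIDE THE STUCK SET** of exponents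
`p₁ + q₁ < e + q₂ ∧ (p₂ + q₂ < e + p₁ ∨ p₂ + q₂ < e + q₁) ∧ (p₂ + q₁ < 2e < p₂ + q₂ ∨ p₂ + q₁ < e + p₁ < p₂ + q₂ ∨ e + q₁ < p₂ + q₂)`.
What is left of the block `(2,2)` question in the straddling configuration is `Z₊ ≤ 6` inside that set. [this file + `…AnySize`] -/
theorem straddleBlock_anySize_posRoots_le_five_of_not_stuck (e p₁ p₂ q₁ q₂ : ℕ) (h2e : p₂ < e) (he1 : e < p₁) (heq : e < q₁)
    (h12 : q₁ < q₂)
    (hS : ¬ (p₁ + q₁ < e + q₂ ∧ (p₂ + q₂ < e + p₁ ∨ p₂ + q₂ < e + q₁)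
      ∧ ((p₂ + q₁ < 2 * e ∧ 2 * e < p₂ + q₂) ∨ (p₂ + q₁ < e + p₁ ∧ e + p₁ < p₂ + q₂) ∨ e + q₁ < p₂ + q₂)))
    (J : Matrix (Fin (m + 2)) (Fin (m + 2)) ℝ) (hJ : J.det < 0) (u v : Fin (m + 2) → ℝ) (c₁ c₂ c₃ c₄ : ℝ)
    (hc₁ : 0 < c₁) (hc₂ : 0 < c₂) (hc₃ : 0 < c₃) (hc₄ : 0 < c₄)
    (hmu : J.det * (u ⬝ᵥ J⁻¹ *ᵥ u) < 0) (hmv : J.det * (v ⬝ᵥ J⁻¹ *ᵥ v) ≤ 0)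
    (hD2 : 0 < J.det * ((u ⬝ᵥ J⁻¹ *ᵥ u) * (v ⬝ᵥ J⁻¹ *ᵥ v) - (u ⬝ᵥ J⁻¹ *ᵥ v) * (v ⬝ᵥ J⁻¹ *ᵥ u))) :
    ((Matrix.det (((X : ℝ[X]) ^ e) • J.map Polynomial.C
        + (Polynomial.C c₁ * X ^ p₁ + Polynomial.C c₂ * X ^ p₂) • (vecMulVec u u).map Polynomial.C
        + (Polynomial.C c₃ * X ^ q₁ + Polynomial.C c₄ * X ^ q₂) • (vecMulVec v v).map Polynomial.C)).roots.toFinset.filter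
        (fun t => 0 < t)).card ≤ 5 := by
  rw [AnySize.posRoots_twoDir_anySize_eq e J hJ.ne u v _ _, AnySize.Φ_block22_eq_nineNomial]
  exact straddleBlock_nineNomial_le_five_of_not_stuck e p₁ p₂ q₁ q₂ h2e he1 heq h12 hS _ _ _ _ c₁ c₂ c₃ c₄ hc₁ hc₂ hc₃ hc₄ hJ.le
    hmu hmv hD2

end Summit.ValiantsHypothesis.ValiantsHypothesis.Theorems.LacunarySymmetroidMatrixDescartes.Pivot.TwoDirections.BlockStraddle
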